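import Summits.QuantumFields.BalabanUV.Gaps.D1WardTraceForm
import Summits.QuantumFields.BalabanUV.Gaps.D1ReynoldsMeanDrift
import Summits.QuantumFields.BalabanUV.Beta.D1BFx.RoadEnd
import Summits.QuantumFields.BalabanUV.Beta.EriceRemainderEnclosureDriftSigned

/-!
# `BalabanUV.Gaps.D1WardLimitTests` — cell pub-balaban-gaps, row (D1), seat g1-p1: THE PIN-FREE LIMIT FACE OF (D1) UNDER THE WARD BINDER — wherever ONE diagonal longitudinal moment
# (or the trace scalar) CONVERGES, (D1) pins its limit to the universal number; summable deviations of that moment GIVE (D1); a wrong limit REFUTES it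

HONEST FRAMING (cell rule, page 1 of everything): [folklore] composition BY NAME — row 86 of this seat (`D1WardLongitudinalForm.secondMoment_TbalOf_…_eq_neg_half_of_hW`), row 88
(`D1WardTraceForm.twelve_mul_secondMoment_reynoldsMean_…_eq_trace_of_hW`), GEN 14 (`D1ReynoldsMeanDrift.d1Drift_six_to_reynoldsMean_…`), road BF-x's
`D1BFx.RoadEnd.tendsto_cesaro_of_oneLoopDrift`, the Erice lane's `EriceRemainderEnclosureDriftSigned.oneLoopDrift_of_summable_abs`, Mathlib's `Filter.Tendsto.cesaro`, an2∕an4's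
`OneStepKernelFamily.D1Drift`.  The Ward binder `hW` (5.9) [Balaban1987RG1 p. 293] REMAINS A HYPOTHESIS on members of the cells' OWN literals; the convergence ∕ summability inputs are
HYPOTHESES (at the pin `cE₂ = Lc^8` g1-p3's rate certificate supplies them — row 86 §3; here NO pin and NO certificate is assumed); nothing of Bałaban's asserted beyond print; NO coefficient
computed or signed; (D1) NOT discharged; 0∕4 row-D1 binders at the pinned ∕ (III′) literals; NOT `BetaPertH`, NOT continuum, NOT Clay.
HONEST DEPENDENCY (b2b cell, verbatim): «continuum YM on T⁴ ⇐ BetaPertH ∧ nine spine estimates (0/9 proved); BetaPertH ⇐ (D1) ∧ (D4) ∧ CAP+tail; G-an2-4 gates asym, D1 and NE2/3/4.»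

WHY (census row 91 of `HOME/g1/RESIDUE.md`).  Row 86 §3 read (D1) AT THE PIN as «lim of the diagonal longitudinal moment = −2·stepBal», using the constructed limit of g1-p3's rate
certificate; row 90 gave the pin-free Cesàro tests.  The two halves of what a certificate provides can be SEPARATED and stated pin-free, at every `cE₂`: (N) a drift law pins the Cesàro
limit, a convergent sequence has the same Cesàro limit, so under `∀ j hW_j` **(D1) at (μ,ν) and convergence of `j ↦ Σ_z T_j(ν,ν,z) z_μ²` to ANY `L` force `L = −2·stepBal N Lc`** — a
wrong limit REFUTES (D1) (no rate needed, only convergence); (S) **summability `Σ_j |−½ Σ_z T_j(ν,ν,z) z_μ² − stepBal N Lc| < ∞` GIVES (D1) at (μ,ν)** (defect = the ℓ¹ norm) — the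
rate certificate's geometric tail is one way to get it, any ℓ¹ control is enough; (N′) at the six channels, convergence of the trace scalar `Σ_z tr T_j(z)|z|²` to `L` forces
`L = −24·stepBal N Lc`.
WHAT IT IS NOT: nothing is discharged; the words of the row do not move.

CONTENT (all [folklore]; no `def`, 0 sorry): §0 `eq_of_oneLoopDrift_of_tendsto` (a drift law and a limit of the same sequence: the limit IS the slope); §1 pinned family (any `1 ≤ Lc`,
root, colours, `cE₂`, `cB`, `T`): **`lim_longitudinal_eq_of_d1Drift_of_hW`**, **`not_d1Drift_of_tendsto_longitudinal_of_ne_of_hW`**, **`d1Drift_of_summable_longitudinal_of_hW`**,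
`lim_trace_eq_of_d1Drift_six_of_hW`; §2 the (III′) literal `JsB12CombShSym hLc N tabs cΛ cB` (`Odd Lc`, every table record): `lim_longitudinal_JsB12CombShSym_eq_of_d1Drift_of_hW`,
`not_d1Drift_JsB12CombShSym_of_tendsto_longitudinal_of_ne_of_hW`, `d1Drift_JsB12CombShSym_of_summable_longitudinal_of_hW`, `lim_trace_JsB12CombShSym_eq_of_d1Drift_six_of_hW`.

Provenance: cell pub-balaban-gaps, seat g1-p1 GEN 17 (prover-pub-balaban-gaps-g1-p1-g17-0), 2026-08-25; imports this seat's `Gaps/D1WardTraceForm` (p402435 ✓) + GEN 14's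
`Gaps/D1ReynoldsMeanDrift` + road BF-x's `Beta/D1BFx/RoadEnd` + the Erice lane's `Beta/EriceRemainderEnclosureDriftSigned` (all built); no existing file touched.
-/

noncomputable section

open Filter Topology
open Literature.MathematicalPhysics.QuantumFieldTheory Balaban1983to89 Balaban1983to89.Beta
open OneStepResolventKernel (JetData)
open OneStepKernelFamily (TbalOf flipK D1Drift)
open PolarizationSign (WardTransversal)
open Drift (OneLoopDrift)
open AffineAveraging (box)
open Summit.QuantumFields.BalabanUV.Beta.MixedJetTablesPlug (JsBalAn1)
open Summit.QuantumFields.BalabanUV.Beta.CombChartJointEnd (JsB12CombShSym)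
open Summit.QuantumFields.BalabanUV.Beta.SymmetrisedStepJets (SymTables)
open Summit.QuantumFields.BalabanUV.Beta.D1BFx.PermCovariantReynolds (reynoldsMean)
open Summit.QuantumFields.BalabanUV.Beta.D1BFx.RoadEnd (tendsto_cesaro_of_oneLoopDrift)
open Summit.QuantumFields.BalabanUV.Beta.EriceRemainderEnclosureDriftSigned (oneLoopDrift_of_summable_abs)
open Summit.QuantumFields.BalabanUV.Gaps.D1ReynoldsMeanDrift (d1Drift_six_to_reynoldsMean_JsBalAn1 d1Drift_six_to_reynoldsMean_JsB12CombShSym)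
open Summit.QuantumFields.BalabanUV.Gaps.D1WardLongitudinalForm (secondMoment_TbalOf_JsBalAn1_eq_neg_half_of_hW secondMoment_TbalOf_JsB12CombShSym_eq_neg_half_of_hW)
open Summit.QuantumFields.BalabanUV.Gaps.D1WardTraceForm (twelve_mul_secondMoment_reynoldsMean_JsBalAn1_eq_trace_of_hW twelve_mul_secondMoment_reynoldsMean_JsB12CombShSym_eq_trace_of_hW)

namespace Summit.QuantumFields.BalabanUV.Gaps.D1WardLimitTests

/-! ## §0 A drift law and a limit of the same sequence -/

/-- [folklore] **A DRIFT LAW PINS THE LIMIT**: if `|Σ_{j<k} f j − b·k| ≤ A` for all `k` and `f j → L`, then `L = b` (both are the Cesàro limit — road BF-x's `tendsto_cesaro_of_oneLoopDrift`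
and Mathlib's `Filter.Tendsto.cesaro`). -/
theorem eq_of_oneLoopDrift_of_tendsto {b A L : ℝ} {f : ℕ → ℝ} (h : OneLoopDrift b A f) (hf : Tendsto f atTop (𝓝 L)) : L = b := by
  have h1 := hf.cesaro
  have h2 := tendsto_cesaro_of_oneLoopDrift h
  have e : (fun m : ℕ => (∑ j ∈ Finset.range m, f j) / (m : ℝ)) = fun m : ℕ => ((m : ℝ))⁻¹ * ∑ j ∈ Finset.range m, f j :=
    funext fun m => div_eq_inv_mul _ _
  rw [e] at h2
  exact tendsto_nhds_unique h1 h2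

/-! ## §1 The β-lead's family `JsBalAn1(r; c⃗; cE₂; cB; T)` — no pin, no certificate -/

section Pinned

variable {Lc : ℕ} [NeZero Lc] {r : Fin (3 + 1) → ℕ}

/-- [folklore] **(D1) PINS THE LIMIT OF ONE DIAGONAL LONGITUDINAL MOMENT WHEREVER IT EXISTS** (any `cE₂`, `μ ≠ ν`, under `∀ j hW_j`): `D1Drift Lc (JsBalAn1 …) N μ ν` and
`Σ_z T_j(ν,ν,z) z_μ² → L` force `L = −2·stepBal N Lc`. -/
theorem lim_longitudinal_eq_of_d1Drift_of_hW (hLc : 1 ≤ Lc) (hr : r ∈ box (3 + 1) Lc) (cE cVH cΛ cE₂ cB : ℝ) (T : Fin 4 → Fin 4 → Fin 4 → Fin 4 → ℝ) {μ ν : Fin 4} (hμν : μ ≠ ν) (N : ℝ)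
    (hW : ∀ j : ℕ, WardTransversal (flipK (TbalOf Lc (JsBalAn1 hLc hr cE cVH cΛ cE₂ cB T) j))) (hD : D1Drift Lc (JsBalAn1 hLc hr cE cVH cΛ cE₂ cB T) N μ ν) {L : ℝ}
    (hL : Tendsto (fun j : ℕ => ∑' z, TbalOf Lc (JsBalAn1 hLc hr cE cVH cΛ cE₂ cB T) j ν ν z * (z μ : ℝ) ^ 2) atTop (𝓝 L)) :
    L = -2 * B12Normalization.stepBal N Lc := by
  obtain ⟨A, hA⟩ := hD
  have hm : Tendsto (fun j : ℕ => B12Beta.secondMoment (TbalOf Lc (JsBalAn1 hLc hr cE cVH cΛ cE₂ cB T) j) μ ν) atTop (𝓝 (-(1 / 2) * L)) :=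
    (hL.const_mul (-(1 / 2))).congr fun j => (secondMoment_TbalOf_JsBalAn1_eq_neg_half_of_hW hLc hr cE cVH cΛ cE₂ cB T j (hW j) hμν).symm
  have h := eq_of_oneLoopDrift_of_tendsto hA hm
  linarith

/-- [folklore] **A WRONG LIMIT REFUTES (D1), PIN-FREE**: under `∀ j hW_j`, if `Σ_z T_j(ν,ν,z) z_μ² → L ≠ −2·stepBal N Lc` then `¬ D1Drift Lc (JsBalAn1 …) N μ ν` (convergence only — no rate). -/
theorem not_d1Drift_of_tendsto_longitudinal_of_ne_of_hW (hLc : 1 ≤ Lc) (hr : r ∈ box (3 + 1) Lc) (cE cVH cΛ cE₂ cB : ℝ) (T : Fin 4 → Fin 4 → Fin 4 → Fin 4 → ℝ) {μ ν : Fin 4}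
    (hμν : μ ≠ ν) (N : ℝ) (hW : ∀ j : ℕ, WardTransversal (flipK (TbalOf Lc (JsBalAn1 hLc hr cE cVH cΛ cE₂ cB T) j))) {L : ℝ}
    (hL : Tendsto (fun j : ℕ => ∑' z, TbalOf Lc (JsBalAn1 hLc hr cE cVH cΛ cE₂ cB T) j ν ν z * (z μ : ℝ) ^ 2) atTop (𝓝 L)) (hne : L ≠ -2 * B12Normalization.stepBal N Lc) :
    ¬ D1Drift Lc (JsBalAn1 hLc hr cE cVH cΛ cE₂ cB T) N μ ν :=
  fun hD => hne (lim_longitudinal_eq_of_d1Drift_of_hW hLc hr cE cVH cΛ cE₂ cB T hμν N hW hD hL)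

/-- [folklore] **SUMMABLE DEVIATIONS OF ONE DIAGONAL LONGITUDINAL MOMENT GIVE (D1), PIN-FREE**: under `∀ j hW_j`, `Σ_j |−½ Σ_z T_j(ν,ν,z) z_μ² − stepBal N Lc| < ∞` ⟹
`D1Drift Lc (JsBalAn1 …) N μ ν` (defect = the ℓ¹ norm; the Erice lane's `oneLoopDrift_of_summable_abs`). -/
theorem d1Drift_of_summable_longitudinal_of_hW (hLc : 1 ≤ Lc) (hr : r ∈ box (3 + 1) Lc) (cE cVH cΛ cE₂ cB : ℝ) (T : Fin 4 → Fin 4 → Fin 4 → Fin 4 → ℝ) {μ ν : Fin 4} (hμν : μ ≠ ν)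
    (N : ℝ) (hW : ∀ j : ℕ, WardTransversal (flipK (TbalOf Lc (JsBalAn1 hLc hr cE cVH cΛ cE₂ cB T) j)))
    (hs : Summable fun j : ℕ => |-(1 / 2) * (∑' z, TbalOf Lc (JsBalAn1 hLc hr cE cVH cΛ cE₂ cB T) j ν ν z * (z μ : ℝ) ^ 2) - B12Normalization.stepBal N Lc|) :
    D1Drift Lc (JsBalAn1 hLc hr cE cVH cΛ cE₂ cB T) N μ ν := by
  have e : (fun j : ℕ => B12Beta.secondMoment (TbalOf Lc (JsBalAn1 hLc hr cE cVH cΛ cE₂ cB T) j) μ ν) =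
      fun j : ℕ => -(1 / 2) * ∑' z, TbalOf Lc (JsBalAn1 hLc hr cE cVH cΛ cE₂ cB T) j ν ν z * (z μ : ℝ) ^ 2 :=
    funext fun j => secondMoment_TbalOf_JsBalAn1_eq_neg_half_of_hW hLc hr cE cVH cΛ cE₂ cB T j (hW j) hμν
  unfold D1Drift
  rw [e]
  exact ⟨_, oneLoopDrift_of_summable_abs hs⟩

/-- [folklore] **(D1) AT THE SIX CHANNELS PINS THE LIMIT OF THE TRACE SCALAR WHEREVER IT EXISTS**: under `∀ j hW_j`, `(∀ a<b, D1Drift … N a b)` and `Σ_ν Σ_z T_j(ν,ν,z)|z|² → L` force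
`L = −24·stepBal N Lc` (GEN 14's Reynolds-mean drift + row 88's trace form). -/
theorem lim_trace_eq_of_d1Drift_six_of_hW (hLc : 1 ≤ Lc) (hr : r ∈ box (3 + 1) Lc) (cE cVH cΛ cE₂ cB : ℝ) (T : Fin 4 → Fin 4 → Fin 4 → Fin 4 → ℝ) (N : ℝ)
    (h : ∀ p ∈ (Finset.univ.filter fun p : Fin 4 × Fin 4 => p.1 < p.2), D1Drift Lc (JsBalAn1 hLc hr cE cVH cΛ cE₂ cB T) N p.1 p.2)
    (hW : ∀ j : ℕ, WardTransversal (flipK (TbalOf Lc (JsBalAn1 hLc hr cE cVH cΛ cE₂ cB T) j))) {L : ℝ}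
    (hL : Tendsto (fun j : ℕ => ∑ ν, ∑' z, TbalOf Lc (JsBalAn1 hLc hr cE cVH cΛ cE₂ cB T) j ν ν z * ∑ μ, (z μ : ℝ) ^ 2) atTop (𝓝 L)) :
    L = -24 * B12Normalization.stepBal N Lc := by
  have h01 : (0 : Fin 4) ≠ 1 := by decide
  obtain ⟨A, hA⟩ := d1Drift_six_to_reynoldsMean_JsBalAn1 hLc hr cE cVH cΛ cE₂ cB T N h h01
  have hm : Tendsto (fun j : ℕ => B12Beta.secondMoment (reynoldsMean (flipK (TbalOf Lc (JsBalAn1 hLc hr cE cVH cΛ cE₂ cB T) j))) 0 1) atTop (𝓝 (-(1 / 24) * L)) := by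
    refine (hL.const_mul (-(1 / 24))).congr fun j => ?_
    have h12 := twelve_mul_secondMoment_reynoldsMean_JsBalAn1_eq_trace_of_hW hLc hr cE cVH cΛ cE₂ cB T j (hW j) h01
    linarith
  have h' := eq_of_oneLoopDrift_of_tendsto hA hm
  linarith

end Pinned

/-! ## §2 The b2b wall's (III′) literal over every table record -/

section Record

variable {Lc : ℕ} [NeZero Lc]

/-- [folklore] **(D1) FOR THE (III′) LITERAL PINS THE LIMIT OF ONE DIAGONAL LONGITUDINAL MOMENT WHEREVER IT EXISTS**: `L = −2·stepBal Nc Lc`. -/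
theorem lim_longitudinal_JsB12CombShSym_eq_of_d1Drift_of_hW (hLc : Odd Lc) (N : ℕ) (tabs : SymTables 3 Lc) (cΛ cB : ℝ) {μ ν : Fin 4} (hμν : μ ≠ ν) (Nc : ℝ)
    (hW : ∀ j : ℕ, WardTransversal (flipK (TbalOf Lc (JsB12CombShSym hLc N tabs cΛ cB) j))) (hD : D1Drift Lc (JsB12CombShSym hLc N tabs cΛ cB) Nc μ ν) {L : ℝ}
    (hL : Tendsto (fun j : ℕ => ∑' z, TbalOf Lc (JsB12CombShSym hLc N tabs cΛ cB) j ν ν z * (z μ : ℝ) ^ 2) atTop (𝓝 L)) :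
    L = -2 * B12Normalization.stepBal Nc Lc := by
  obtain ⟨A, hA⟩ := hD
  have hm : Tendsto (fun j : ℕ => B12Beta.secondMoment (TbalOf Lc (JsB12CombShSym hLc N tabs cΛ cB) j) μ ν) atTop (𝓝 (-(1 / 2) * L)) :=
    (hL.const_mul (-(1 / 2))).congr fun j => (secondMoment_TbalOf_JsB12CombShSym_eq_neg_half_of_hW hLc N tabs cΛ cB j (hW j) hμν).symm
  have h := eq_of_oneLoopDrift_of_tendsto hA hm
  linarith

/-- [folklore] **A WRONG LIMIT REFUTES (D1) FOR THE (III′) LITERAL, PIN-FREE.** -/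
theorem not_d1Drift_JsB12CombShSym_of_tendsto_longitudinal_of_ne_of_hW (hLc : Odd Lc) (N : ℕ) (tabs : SymTables 3 Lc) (cΛ cB : ℝ) {μ ν : Fin 4} (hμν : μ ≠ ν) (Nc : ℝ)
    (hW : ∀ j : ℕ, WardTransversal (flipK (TbalOf Lc (JsB12CombShSym hLc N tabs cΛ cB) j))) {L : ℝ}
    (hL : Tendsto (fun j : ℕ => ∑' z, TbalOf Lc (JsB12CombShSym hLc N tabs cΛ cB) j ν ν z * (z μ : ℝ) ^ 2) atTop (𝓝 L)) (hne : L ≠ -2 * B12Normalization.stepBal Nc Lc) :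
    ¬ D1Drift Lc (JsB12CombShSym hLc N tabs cΛ cB) Nc μ ν :=
  fun hD => hne (lim_longitudinal_JsB12CombShSym_eq_of_d1Drift_of_hW hLc N tabs cΛ cB hμν Nc hW hD hL)

/-- [folklore] **SUMMABLE DEVIATIONS OF ONE DIAGONAL LONGITUDINAL MOMENT GIVE (D1) FOR THE (III′) LITERAL, PIN-FREE.** -/
theorem d1Drift_JsB12CombShSym_of_summable_longitudinal_of_hW (hLc : Odd Lc) (N : ℕ) (tabs : SymTables 3 Lc) (cΛ cB : ℝ) {μ ν : Fin 4} (hμν : μ ≠ ν) (Nc : ℝ)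
    (hW : ∀ j : ℕ, WardTransversal (flipK (TbalOf Lc (JsB12CombShSym hLc N tabs cΛ cB) j)))
    (hs : Summable fun j : ℕ => |-(1 / 2) * (∑' z, TbalOf Lc (JsB12CombShSym hLc N tabs cΛ cB) j ν ν z * (z μ : ℝ) ^ 2) - B12Normalization.stepBal Nc Lc|) :
    D1Drift Lc (JsB12CombShSym hLc N tabs cΛ cB) Nc μ ν := by
  have e : (fun j : ℕ => B12Beta.secondMoment (TbalOf Lc (JsB12CombShSym hLc N tabs cΛ cB) j) μ ν) =
      fun j : ℕ => -(1 / 2) * ∑' z, TbalOf Lc (JsB12CombShSym hLc N tabs cΛ cB) j ν ν z * (z μ : ℝ) ^ 2 :=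
    funext fun j => secondMoment_TbalOf_JsB12CombShSym_eq_neg_half_of_hW hLc N tabs cΛ cB j (hW j) hμν
  unfold D1Drift
  rw [e]
  exact ⟨_, oneLoopDrift_of_summable_abs hs⟩

/-- [folklore] **(D1) AT THE SIX CHANNELS OF THE (III′) LITERAL PINS THE LIMIT OF THE TRACE SCALAR WHEREVER IT EXISTS**: `L = −24·stepBal Nc Lc`. -/
theorem lim_trace_JsB12CombShSym_eq_of_d1Drift_six_of_hW (hLc : Odd Lc) (N : ℕ) (tabs : SymTables 3 Lc) (cΛ cB : ℝ) (Nc : ℝ)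
    (h : ∀ p ∈ (Finset.univ.filter fun p : Fin 4 × Fin 4 => p.1 < p.2), D1Drift Lc (JsB12CombShSym hLc N tabs cΛ cB) Nc p.1 p.2)
    (hW : ∀ j : ℕ, WardTransversal (flipK (TbalOf Lc (JsB12CombShSym hLc N tabs cΛ cB) j))) {L : ℝ}
    (hL : Tendsto (fun j : ℕ => ∑ ν, ∑' z, TbalOf Lc (JsB12CombShSym hLc N tabs cΛ cB) j ν ν z * ∑ μ, (z μ : ℝ) ^ 2) atTop (𝓝 L)) :
    L = -24 * B12Normalization.stepBal Nc Lc := by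
  have h01 : (0 : Fin 4) ≠ 1 := by decide
  obtain ⟨A, hA⟩ := d1Drift_six_to_reynoldsMean_JsB12CombShSym hLc N tabs cΛ cB Nc h h01
  have hm : Tendsto (fun j : ℕ => B12Beta.secondMoment (reynoldsMean (flipK (TbalOf Lc (JsB12CombShSym hLc N tabs cΛ cB) j))) 0 1) atTop (𝓝 (-(1 / 24) * L)) := by
    refine (hL.const_mul (-(1 / 24))).congr fun j => ?_
    have h12 := twelve_mul_secondMoment_reynoldsMean_JsB12CombShSym_eq_trace_of_hW hLc N tabs cΛ cB j (hW j) h01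
    linarith
  have h' := eq_of_oneLoopDrift_of_tendsto hA hm
  linarith

end Record

end Summit.QuantumFields.BalabanUV.Gaps.D1WardLimitTests

end
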